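import Literature.Algebra.EuclideanLattices.RegevPointSetShiftBound
import Mathlib.Analysis.Complex.ExponentialBounds
import Mathlib.Analysis.SpecificLimits.Normed
import Mathlib.Data.Nat.Size
import HarnessLib

/-!
# Regev's reduction `uSVP ≤ DCP`: the numerical side of the choice of parameters

Fourteenth file (XIV-a) of the construction discharging `usvp_of_dihedralCoset` (Regev 2004,
Thm. 1.1): the real inequalities behind the parameters of the proof of Lemma 3.12 (p. 14: the
modulus `p`, the number of levels `Q` of the quantised ball, its radius `R = c_bal n^{1/2+2f} λ₁`
guessed up to a factor `√2`, the box size `M = 2^{4n}`), in the form consumed by the fibre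
counting of file XII (`hfrac_of_numeric`: `(∑|δᵢ|)/M + 2 ε ≤ η`, `η = 1/(log₂ N)^f`,
`ε = shiftEps`). Everything here is real analysis, PROVED:

* `shiftEps_le_of_small` — **the relative shift error is small**: for `2n ≤ Q`, `5√n ≤ S = √(QΔ)`,
  `2√n ≤ σ` and `8n (n/Q + (√n + 1)/S) ≤ τ ≤ 1`, `shiftEps (n−1) Q Δ σ ≤ τ + 6 √n σ / S`
  (Bernoulli and `eˣ ≤ 1 + 2x` on `[0, 1]`);
* `innerRad_pos_of` — `0 < innerRad` under the same hypotheses;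
* the constants `kOf f = ⌈f⌉₊`, `cA f = 140 · 5^{kOf f}` and the level count `Qof f n`, with
  `eta_ge` (`η ≥ (5n²)^{-f} ≥ 5^{-k} n^{-2k}`) and the final budget `hnum_of_bounds`.

## References

* O. Regev, *Quantum computation and lattice problems*, SIAM J. Comput. 33 (2004), proof of
  Lemma 3.12 (p. 14) and Claim 3.14 (p. 15), Cor. 3.9, Claim 3.7.
-/

noncomputable section

namespace Literature.Algebra.EuclideanLattices

namespace Regev2004

open Real

/-! ### Elementary real inequalities -/

/-- `e^{1/2} ≤ 2`. [folklore] -/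
private theorem exp_half_le_two : Real.exp (1 / 2) ≤ 2 := by
  have h : Real.exp (1 / 2) ^ 2 = Real.exp 1 := by rw [← Real.exp_nat_mul]; norm_num
  have h1 : Real.exp 1 < 4 := by have := Real.exp_one_lt_d9; linarith
  nlinarith [Real.exp_pos (1 / 2)]

/-- `secConst m ≤ √(m+1)`. [folklore] -/
theorem secConst_le (m : ℕ) : secConst m ≤ Real.sqrt (m + 1 : ℝ) := by
  unfold secConst
  have h := exp_half_le_two
  have hs : 0 ≤ Real.sqrt (m + 1 : ℝ) := Real.sqrt_nonneg _
  calc Real.exp (1 / 2) * Real.sqrt (m + 1 : ℝ) / 2 ≤ 2 * Real.sqrt (m + 1 : ℝ) / 2 := by gcongr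
    _ = Real.sqrt (m + 1 : ℝ) := by ring

/-- `eˣ ≤ 1 + 2x` on `[0, 1]`. [folklore] -/
private theorem exp_le_one_add_two_mul {x : ℝ} (h0 : 0 ≤ x) (h1 : x ≤ 1) : Real.exp x ≤ 1 + 2 * x := by
  have h := Real.abs_exp_sub_one_sub_id_le (show |x| ≤ 1 by rw [abs_of_nonneg h0]; exact h1)
  have h2 : Real.exp x - 1 - x ≤ x ^ 2 := (le_abs_self _).trans h
  nlinarith

/-- `(1 + x)ⁿ ≤ e^{n x}` for `0 ≤ x`. [folklore] -/
private theorem one_add_pow_le_exp_mul {x : ℝ} (h0 : 0 ≤ x) (n : ℕ) : (1 + x) ^ n ≤ Real.exp (n * x) := by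
  rw [Real.exp_nat_mul]
  exact pow_le_pow_left₀ (by linarith) (by have := Real.add_one_le_exp x; linarith) n

/-- **`(1 + 4w)ⁿ ≤ 1 + 8 n w`** when `4 n w ≤ 1`. [folklore] -/
theorem one_add_four_mul_pow_le {w : ℝ} (h0 : 0 ≤ w) {n : ℕ} (h : 4 * n * w ≤ 1) : (1 + 4 * w) ^ n ≤ 1 + 8 * n * w := by
  have h1 := one_add_pow_le_exp_mul (show 0 ≤ 4 * w by linarith) n
  have h2 := exp_le_one_add_two_mul (show 0 ≤ (n : ℝ) * (4 * w) by positivity) (by linarith)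
  linarith

/-- `(1 + u)/(1 − w) ≤ 1 + 4w` for `0 ≤ u ≤ w ≤ 1/2`. [folklore] -/
theorem ratio_le_one_add_four_mul {u w : ℝ} (hu : 0 ≤ u) (huw : u ≤ w) (hw : w ≤ 1 / 2) : (1 + u) / (1 - w) ≤ 1 + 4 * w := by
  rw [div_le_iff₀ (by linarith)]
  nlinarith

/-! ### The relative shift error is small -/

/-- **`0 < innerRad`** for `2n ≤ Q` and `5√n ≤ √(QΔ)`. [folklore] -/
theorem innerRad_ge {n Q Δ : ℕ} (hn : 1 ≤ n) (hQ : 2 * n ≤ Q) (hS : 5 * Real.sqrt n ≤ Real.sqrt ((Q : ℝ) * Δ)) :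
    Real.sqrt ((Q : ℝ) * Δ) / 2 ≤ innerRad (n - 1) Q Δ := by
  have hn' : ((n - 1 : ℕ) : ℝ) + 1 = n := by rw [Nat.cast_sub hn]; push_cast; ring
  unfold innerRad
  rw [hn']
  set S := Real.sqrt ((Q : ℝ) * Δ) with hSdef
  have hS0 : 0 ≤ S := Real.sqrt_nonneg _
  have hsq0 : 0 ≤ Real.sqrt (n : ℝ) := Real.sqrt_nonneg _
  -- `√((Q − n) Δ) ≥ S / √2 ≥ 0.7 S`
  have h1 : S ^ 2 / 2 ≤ ((Q : ℝ) - n) * Δ := by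
    rw [hSdef, Real.sq_sqrt (by positivity)]
    have : (2 * n : ℝ) ≤ Q := by exact_mod_cast hQ
    have hΔ : (0 : ℝ) ≤ Δ := Nat.cast_nonneg _
    nlinarith
  have h2 : S * (7 / 10) ≤ Real.sqrt (((Q : ℝ) - n) * Δ) := by
    apply Real.le_sqrt_of_sq_le
    nlinarith
  linarith

/-- **`0 < innerRad`.** [folklore] -/
theorem innerRad_pos_of {n Q Δ : ℕ} (hn : 1 ≤ n) (hQ : 2 * n ≤ Q) (hS : 5 * Real.sqrt n ≤ Real.sqrt ((Q : ℝ) * Δ))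
    (hS0 : 0 < Real.sqrt ((Q : ℝ) * Δ)) : 0 < innerRad (n - 1) Q Δ :=
  lt_of_lt_of_le (by linarith) (innerRad_ge hn hQ hS)

/-- **The relative shift error is small** (Regev, p. 15: "both error terms are at most `1/(c (log N)^f)`
for our choice of parameters"): with `S = √(QΔ)`, for `2n ≤ Q`, `5√n ≤ S`, `2√n ≤ σ` and
`8 n (n/Q + (√n + 1)/S) ≤ τ ≤ 1`, `shiftEps (n−1) Q Δ σ ≤ τ + 6 √n σ / S`. [cite: Regev2004, Claim 3.14 (p. 15) with Cor. 3.9 and Claim 3.7] -/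
theorem shiftEps_le_of_small {n Q Δ : ℕ} (hn : 1 ≤ n) (hQ : 2 * n ≤ Q) (hS : 5 * Real.sqrt n ≤ Real.sqrt ((Q : ℝ) * Δ))
    {σ τ : ℝ} (hσ : 2 * Real.sqrt n ≤ σ) (hτ1 : τ ≤ 1)
    (hw : 8 * n * ((n : ℝ) / Q + (Real.sqrt n + 1) / Real.sqrt ((Q : ℝ) * Δ)) ≤ τ) :
    shiftEps (n - 1) Q Δ σ ≤ τ + 6 * Real.sqrt n * σ / Real.sqrt ((Q : ℝ) * Δ) := by
  have hn' : ((n - 1 : ℕ) : ℝ) + 1 = n := by rw [Nat.cast_sub hn]; push_cast; ring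
  have hpow : n - 1 + 1 = n := Nat.sub_add_cancel hn
  set S := Real.sqrt ((Q : ℝ) * Δ) with hSdef
  set rn := Real.sqrt (n : ℝ) with hrn
  have hrn0 : 0 ≤ rn := Real.sqrt_nonneg _
  have hrn1 : 1 ≤ rn := by rw [hrn]; exact Real.one_le_sqrt.2 (by exact_mod_cast hn)
  have hS5 : 5 * rn ≤ S := hS
  have hSpos : 0 < S := lt_of_lt_of_le (by linarith) hS5
  have hn1 : (1 : ℝ) ≤ n := by exact_mod_cast hn
  have hQ2 : (2 * n : ℝ) ≤ Q := by exact_mod_cast hQ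
  have hQpos : (0 : ℝ) < Q := by linarith
  -- the small quantities
  set v : ℝ := (n : ℝ) / Q with hv
  set u : ℝ := (rn + 1) / S with hu
  have hv0 : 0 ≤ v := by positivity
  have hu0 : 0 ≤ u := by positivity
  have hτ0 : 0 ≤ τ := le_trans (by positivity) hw
  have hw' : 8 * n * (v + u) ≤ τ := hw
  have hvu : v + u ≤ 1 / 8 := by
    have : 8 * (v + u) ≤ 8 * n * (v + u) := by nlinarith
    linarith
  -- the radii
  have hr_lo : S / 2 ≤ innerRad (n - 1) Q Δ := innerRad_ge hn hQ hS
  have hrpos : 0 < innerRad (n - 1) Q Δ := lt_of_lt_of_le (by linarith) hr_lo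
  have hR_eq : outerRad (n - 1) Q Δ = S + rn + 1 := by unfold outerRad; rw [hn']
  have hRpos : 0 < outerRad (n - 1) Q Δ := outerRad_pos _ _ _
  -- `innerRad ≥ S (1 − v − u)`: from `√((Q − n)Δ) ≥ S (1 − v)`
  have hr_lo' : S * (1 - v - u) ≤ innerRad (n - 1) Q Δ := by
    unfold innerRad; rw [hn']
    have h1 : S * (1 - v) ≤ Real.sqrt (((Q : ℝ) - n) * Δ) := by
      apply Real.le_sqrt_of_sq_le
      have e1 : (S * (1 - v)) ^ 2 = (Q : ℝ) * Δ * (1 - v) ^ 2 := by rw [mul_pow, hSdef, Real.sq_sqrt (by positivity)]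
      rw [e1, hv]
      have hΔ : (0 : ℝ) ≤ Δ := Nat.cast_nonneg _
      have hv1 : (n : ℝ) / Q ≤ 1 / 2 := by rw [div_le_iff₀ hQpos]; linarith
      have key : (Q : ℝ) * (1 - (n : ℝ) / Q) ^ 2 ≤ (Q : ℝ) - n := by
        have e2 : (Q : ℝ) * (1 - (n : ℝ) / Q) ^ 2 = Q - 2 * n + n * ((n : ℝ) / Q) := by field_simp; ring
        rw [e2]; nlinarith
      nlinarith
    have e3 : S * (1 - v - u) = S * (1 - v) - (rn + 1) := by rw [hu]; field_simp
    rw [e3]; linarith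
  -- the ratio `R/r ≤ 1 + 4 (v + u)` and its power
  have hratio : outerRad (n - 1) Q Δ / innerRad (n - 1) Q Δ ≤ 1 + 4 * (v + u) := by
    have h1 : outerRad (n - 1) Q Δ / innerRad (n - 1) Q Δ ≤ (S + rn + 1) / (S * (1 - v - u)) := by
      rw [hR_eq]
      exact div_le_div_of_nonneg_left (by positivity) (by nlinarith) hr_lo'
    have h2 : (S + rn + 1) / (S * (1 - v - u)) = (1 + u) / (1 - (v + u)) := by
      rw [hu]; field_simp; ring
    rw [h2] at h1
    exact h1.trans (ratio_le_one_add_four_mul hu0 (by linarith) (by linarith))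
  have hq1 : 1 ≤ outerRad (n - 1) Q Δ / innerRad (n - 1) Q Δ := by
    rw [le_div_iff₀ hrpos, one_mul]; exact innerRad_le_outerRad _ _ _
  have hqn : (outerRad (n - 1) Q Δ / innerRad (n - 1) Q Δ) ^ (n - 1 + 1) ≤ 1 + τ := by
    rw [hpow]
    refine (pow_le_pow_left₀ (by linarith) hratio n).trans ?_
    have h := one_add_four_mul_pow_le (show 0 ≤ v + u by positivity) (n := n) (by nlinarith)
    linarith
  have hqn1 : 1 ≤ (outerRad (n - 1) Q Δ / innerRad (n - 1) Q Δ) ^ (n - 1 + 1) := one_le_pow₀ hq1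
  -- the three terms
  have hc : secConst (n - 1) ≤ rn := by have := secConst_le (n - 1); rwa [hn'] at this
  have hc0 : 0 ≤ secConst (n - 1) := by unfold secConst; positivity
  have hσ0 : 0 ≤ σ := le_trans (by positivity) hσ
  have t2 : secConst (n - 1) / innerRad (n - 1) Q Δ * σ ≤ 2 * rn * σ / S := by
    have h1 : secConst (n - 1) / innerRad (n - 1) Q Δ ≤ rn / (S / 2) := div_le_div₀ hrn0 hc (by linarith) hr_lo
    have h2 : rn / (S / 2) = 2 * rn / S := by field_simp
    rw [h2] at h1
    calc secConst (n - 1) / innerRad (n - 1) Q Δ * σ ≤ 2 * rn / S * σ := mul_le_mul_of_nonneg_right h1 hσ0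
      _ = 2 * rn * σ / S := by ring
  have t3 : secConst (n - 1) / outerRad (n - 1) Q Δ * (σ + 2 * Real.sqrt ((n - 1 : ℕ) + 1 : ℝ)) *
      (outerRad (n - 1) Q Δ / innerRad (n - 1) Q Δ) ^ (n - 1 + 1) ≤ 4 * rn * σ / S := by
    rw [hn', ← hrn]
    have hRS : S ≤ outerRad (n - 1) Q Δ := by rw [hR_eq]; linarith
    have h1 : secConst (n - 1) / outerRad (n - 1) Q Δ ≤ rn / S :=
      div_le_div₀ hrn0 hc hSpos hRS
    have h2 : σ + 2 * rn ≤ 2 * σ := by linarith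
    calc secConst (n - 1) / outerRad (n - 1) Q Δ * (σ + 2 * rn) * (outerRad (n - 1) Q Δ / innerRad (n - 1) Q Δ) ^ (n - 1 + 1)
        ≤ rn / S * (2 * σ) * (1 + τ) := by gcongr
      _ ≤ rn / S * (2 * σ) * 2 := by gcongr; linarith
      _ = 4 * rn * σ / S := by ring
  unfold shiftEps
  have e : τ + 6 * rn * σ / S = τ + 2 * rn * σ / S + 4 * rn * σ / S := by ring
  rw [e]
  linarith

/-! ### The constants and the budget -/

/-- `k = ⌈f⌉₊`. [folklore] -/
def kOf (f : ℝ) : ℕ := ⌈f⌉₊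

/-- The radius constant `c_A = 140 · 5ᵏ` (`R ∈ (c_A n^{1/2+2f} λ₁/√2, c_A n^{1/2+2f} λ₁]`). [cite: Regev2004, Lemma 3.12 (proof, p. 14: R = c_bal n^{1/2+2f} l)] -/
def cA (f : ℝ) : ℕ := 140 * 5 ^ kOf f

/-- The number of levels `Q = 128 · 5ᵏ · n^{2k+2} + 2n`. [cite: Regev2004, Cor. 3.9 (the quantisation)] -/
def Qof (f : ℝ) (n : ℕ) : ℕ := 128 * 5 ^ kOf f * n ^ (2 * kOf f + 2) + 2 * n

/-- `η(n) = 1/((4n+1) n)^f`, the admissible failure fraction at `N = 2^{(4n+1)n}`. [cite: Regev2004, Def. 1.3] -/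
def eta (f : ℝ) (n : ℕ) : ℝ := 1 / (((4 * n + 1) * n : ℕ) : ℝ) ^ f

/-- `η ≤ 1`. [folklore] -/
theorem eta_le_one {f : ℝ} (hf : 0 < f) {n : ℕ} (hn : 1 ≤ n) : eta f n ≤ 1 := by
  unfold eta
  rw [div_le_one (Real.rpow_pos_of_pos (by positivity) _)]
  exact Real.one_le_rpow (by exact_mod_cast (show 1 ≤ (4 * n + 1) * n from by nlinarith)) hf.le

/-- `0 < η`. [folklore] -/
theorem eta_pos (f : ℝ) {n : ℕ} (hn : 1 ≤ n) : 0 < eta f n := by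
  unfold eta; exact div_pos one_pos (Real.rpow_pos_of_pos (by exact_mod_cast (show 0 < (4 * n + 1) * n from by nlinarith)) _)

/-- **`(5n²)^{-k} ≤ (5 n²)^{-f} ≤ η`** (`k = ⌈f⌉₊`). [folklore] -/
theorem inv_pow_le_eta {f : ℝ} (hf : 0 < f) {n : ℕ} (hn : 1 ≤ n) : 1 / ((5 * (n : ℝ) ^ 2) ^ kOf f) ≤ eta f n := by
  unfold eta
  have hn1 : (1 : ℝ) ≤ n := by exact_mod_cast hn
  have h5 : (1 : ℝ) ≤ 5 * (n : ℝ) ^ 2 := by nlinarith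
  have hbase : (((4 * n + 1) * n : ℕ) : ℝ) ≤ 5 * (n : ℝ) ^ 2 := by push_cast; nlinarith
  have hbase1 : (1 : ℝ) ≤ (((4 * n + 1) * n : ℕ) : ℝ) := by exact_mod_cast (show 1 ≤ (4 * n + 1) * n from by nlinarith)
  rw [div_le_div_iff₀ (by positivity) (Real.rpow_pos_of_pos (by positivity) _), one_mul, one_mul]
  calc (((4 * n + 1) * n : ℕ) : ℝ) ^ f ≤ (5 * (n : ℝ) ^ 2) ^ f := Real.rpow_le_rpow (by positivity) hbase hf.le
    _ ≤ (5 * (n : ℝ) ^ 2) ^ (kOf f : ℝ) := Real.rpow_le_rpow_of_exponent_le h5 (Nat.le_ceil f)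
    _ = (5 * (n : ℝ) ^ 2) ^ kOf f := Real.rpow_natCast _ _

/-- **`n^{-2f}/η ≤ 5ᵏ`**: `n^{-2f} ((4n+1)n)^f = (4 + 1/n)^f ≤ 5^f ≤ 5^k`. [folklore] -/
theorem rpow_neg_div_eta_le {f : ℝ} (hf : 0 < f) {n : ℕ} (hn : 1 ≤ n) : (n : ℝ) ^ (-(2 * f)) / eta f n ≤ 5 ^ kOf f := by
  unfold eta
  have hn0 : (0 : ℝ) < n := by exact_mod_cast hn
  rw [div_div_eq_mul_div, div_one]
  have e : (n : ℝ) ^ (-(2 * f)) * (((4 * n + 1) * n : ℕ) : ℝ) ^ f = ((4 * n + 1 : ℝ) / n) ^ f := by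
    push_cast
    rw [Real.div_rpow (by positivity) hn0.le, Real.mul_rpow (by positivity) hn0.le, Real.rpow_neg hn0.le,
      show (2 * f) = f + f by ring, Real.rpow_add hn0]
    field_simp
  rw [e]
  have hn1 : (1 : ℝ) ≤ n := by exact_mod_cast hn
  have h45 : (4 * n + 1 : ℝ) / n ≤ 5 := by rw [div_le_iff₀ hn0]; linarith
  calc ((4 * n + 1 : ℝ) / n) ^ f ≤ (5 : ℝ) ^ f := Real.rpow_le_rpow (by positivity) h45 hf.le
    _ ≤ (5 : ℝ) ^ (kOf f : ℝ) := Real.rpow_le_rpow_of_exponent_le (by norm_num) (Nat.le_ceil f)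
    _ = 5 ^ kOf f := Real.rpow_natCast _ _

/-- `2n ≤ Q`. [folklore] -/
theorem two_mul_le_Qof (f : ℝ) (n : ℕ) : 2 * n ≤ Qof f n := Nat.le_add_left _ _

/-- **`n/Q ≤ η/(128 n)`** (the level count is large enough). [folklore] -/
theorem div_Qof_le {f : ℝ} (hf : 0 < f) {n : ℕ} (hn : 1 ≤ n) : (n : ℝ) / Qof f n ≤ eta f n / (128 * n) := by
  have h := inv_pow_le_eta hf hn
  have hn0 : (0 : ℝ) < n := by exact_mod_cast hn
  have hQ : (128 * 5 ^ kOf f * (n : ℝ) ^ (2 * kOf f + 2) : ℝ) ≤ Qof f n := by unfold Qof; push_cast; linarith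
  have e : (5 * (n : ℝ) ^ 2) ^ kOf f = 5 ^ kOf f * (n : ℝ) ^ (2 * kOf f) := by rw [mul_pow, ← pow_mul]
  rw [e] at h
  calc (n : ℝ) / Qof f n ≤ n / (128 * 5 ^ kOf f * (n : ℝ) ^ (2 * kOf f + 2)) := div_le_div_of_nonneg_left hn0.le (by positivity) hQ
    _ = 1 / (5 ^ kOf f * (n : ℝ) ^ (2 * kOf f)) / (128 * n) := by field_simp; ring
    _ ≤ eta f n / (128 * n) := div_le_div_of_nonneg_right h (by positivity)

/-! ### The modulus and the eventual inequalities -/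

/-- The modulus `p = 2^{size (2 c_A n^{2k+1} + 2)}`: a power of two above `2 c_A n^{1/2+2f} + 2`, of polynomial size
(so that the residue `m` is guessed among polynomially many values). [cite: Regev2004, Lemma 3.12 (proof, p. 14: a prime p > n^{2+2f}; here a power of two)] -/
def pOf (f : ℝ) (n : ℕ) : ℕ := 2 ^ Nat.size (2 * cA f * n ^ (2 * kOf f + 1) + 2)

/-- `p > 2 c_A n^{2k+1} + 2`. [folklore] -/
theorem lt_pOf (f : ℝ) (n : ℕ) : 2 * cA f * n ^ (2 * kOf f + 1) + 2 < pOf f n := Nat.lt_size_self _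

/-- `2^{size x} ≤ 2x + 1`. [folklore] -/
private theorem two_pow_size_le (x : ℕ) : 2 ^ Nat.size x ≤ 2 * x + 1 := by
  rcases Nat.eq_zero_or_pos x with rfl | hx
  · simp
  · have h : Nat.size x - 1 < Nat.size x := Nat.sub_lt (Nat.size_pos.2 hx) one_pos
    have h2 := Nat.lt_size.1 h
    have e : Nat.size x = Nat.size x - 1 + 1 := by omega
    rw [e, pow_succ]; omega

/-- `p ≤ 2 (2 c_A n^{2k+1} + 2) + 1`. [folklore] -/
theorem pOf_le (f : ℝ) (n : ℕ) : pOf f n ≤ 2 * (2 * cA f * n ^ (2 * kOf f + 1) + 2) + 1 := two_pow_size_le _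

/-- `2 ≤ p` and `p` is a power of two. [folklore] -/
theorem two_le_pOf (f : ℝ) (n : ℕ) : 2 ≤ pOf f n := by have := lt_pOf f n; omega

/-- **Polynomials are eventually below `2ⁿ`.** [folklore] -/
theorem exists_mul_pow_le_two_pow (C d : ℕ) : ∃ n₀ : ℕ, ∀ n, n₀ ≤ n → C * n ^ d ≤ 2 ^ n := by
  have h := tendsto_pow_const_div_const_pow_of_one_lt d (show (1 : ℝ) < 2 by norm_num)
  have hev := h.eventually (gt_mem_nhds (show (0 : ℝ) < 1 / (C + 1) by positivity))
  obtain ⟨n₀, hn₀⟩ := Filter.eventually_atTop.1 hev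
  refine ⟨n₀, fun n hn => ?_⟩
  have h1 := hn₀ n hn
  rw [div_lt_div_iff₀ (by positivity) (by positivity), one_mul] at h1
  have h2 : (C : ℝ) * n ^ d ≤ 2 ^ n := by nlinarith [pow_nonneg (Nat.cast_nonneg n : (0 : ℝ) ≤ n) d]
  exact_mod_cast h2

/-- **The eventual inequalities** behind the parameters, at dimension `n` (for the failure
parameter `f`, `k = ⌈f⌉₊`). [cite: Regev2004, Lemma 3.12 (proof, p. 14: "for n large enough")] -/
structure NumOK (f : ℝ) (n : ℕ) : Prop where
  four_le : 4 ≤ n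
  /-- the guess of the radius is fine relative to `√n`: `256·5ᵏ·n^{2k+2} ≤ 2ⁿ` -/
  e1 : 256 * 5 ^ kOf f * n ^ (2 * kOf f + 2) ≤ 2 ^ n
  /-- the box boundary is negligible: `4·5ᵏ·n^{2k+1} ≤ 2ⁿ` -/
  e2 : 4 * 5 ^ kOf f * n ^ (2 * kOf f + 1) ≤ 2 ^ n
  /-- the modulus is negligible against the box: `4·5ᵏ·n^{2k}·p ≤ 2ⁿ` -/
  e3 : 4 * 5 ^ kOf f * n ^ (2 * kOf f) * pOf f n ≤ 2 ^ n
  /-- the level count is below the radius window: `Q ≤ 2ⁿ` -/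
  e4 : Qof f n ≤ 2 ^ n

/-- **The eventual inequalities hold for all large `n`.** [folklore] -/
theorem exists_numOK (f : ℝ) : ∃ n₀ : ℕ, ∀ n, n₀ ≤ n → NumOK f n := by
  obtain ⟨n₁, h1⟩ := exists_mul_pow_le_two_pow (256 * 5 ^ kOf f) (2 * kOf f + 2)
  obtain ⟨n₂, h2⟩ := exists_mul_pow_le_two_pow (4 * 5 ^ kOf f) (2 * kOf f + 1)
  obtain ⟨n₃, h3⟩ := exists_mul_pow_le_two_pow (4 * 5 ^ kOf f * (4 * cA f + 5)) (2 * kOf f + (2 * kOf f + 1))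
  obtain ⟨n₄, h4⟩ := exists_mul_pow_le_two_pow (128 * 5 ^ kOf f + 2) (2 * kOf f + 2)
  refine ⟨max 4 (max n₁ (max n₂ (max n₃ n₄))), fun n hn => ?_⟩
  simp only [max_le_iff] at hn
  obtain ⟨h4n, hn1, hn2, hn3, hn4⟩ := hn
  refine ⟨h4n, h1 n hn1, h2 n hn2, ?_, ?_⟩
  · refine le_trans ?_ (h3 n hn3)
    have hp := pOf_le f n
    have hn0 : 1 ≤ n := by omega
    calc 4 * 5 ^ kOf f * n ^ (2 * kOf f) * pOf f n ≤ 4 * 5 ^ kOf f * n ^ (2 * kOf f) * (2 * (2 * cA f * n ^ (2 * kOf f + 1) + 2) + 1) :=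
          Nat.mul_le_mul_left _ hp
      _ ≤ 4 * 5 ^ kOf f * n ^ (2 * kOf f) * ((4 * cA f + 5) * n ^ (2 * kOf f + 1)) := by
          apply Nat.mul_le_mul_left
          have : 1 ≤ n ^ (2 * kOf f + 1) := Nat.one_le_pow _ _ hn0
          nlinarith
      _ = 4 * 5 ^ kOf f * (4 * cA f + 5) * n ^ (2 * kOf f + (2 * kOf f + 1)) := by rw [pow_add]; ring
  · refine le_trans ?_ (h4 n hn4)
    have hn0 : 1 ≤ n := by omega
    have : n ≤ n ^ (2 * kOf f + 2) := by
      calc n = n ^ 1 := (pow_one n).symm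
        _ ≤ n ^ (2 * kOf f + 2) := Nat.pow_le_pow_right hn0 (by omega)
    unfold Qof; nlinarith

/-! ### Consequences at a dimension where the inequalities hold -/

section Consequences

variable {f : ℝ} {n : ℕ}

/-- `5 √n ≤ 2ⁿ` (from `25 n ≤ 4ⁿ`, itself from `e1`). [folklore] -/
theorem five_sqrt_le_two_pow (h : NumOK f n) : 5 * Real.sqrt n ≤ (2 : ℝ) ^ n := by
  have h1 : 25 * n ≤ 2 ^ n := by
    have := h.e1
    have hk : n ≤ n ^ (2 * kOf f + 2) := by
      calc n = n ^ 1 := (pow_one n).symm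
        _ ≤ n ^ (2 * kOf f + 2) := Nat.pow_le_pow_right (by have := h.four_le; omega) (by omega)
    have h5 : 1 ≤ 5 ^ kOf f := Nat.one_le_pow _ _ (by norm_num)
    nlinarith
  have h2 : (25 * n : ℝ) ≤ (2 : ℝ) ^ n := by exact_mod_cast h1
  have h3 : (5 * Real.sqrt n) ^ 2 ≤ ((2 : ℝ) ^ n) ^ 2 := by
    rw [mul_pow, Real.sq_sqrt (Nat.cast_nonneg _)]
    have h4 : (2 : ℝ) ^ n ≤ ((2 : ℝ) ^ n) ^ 2 := by
      have : (1 : ℝ) ≤ 2 ^ n := one_le_pow₀ (by norm_num)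
      nlinarith
    linarith
  exact (pow_le_pow_iff_left₀ (by positivity) (by positivity) two_ne_zero).1 h3

/-- `n^{1/2+2f} = √n · n^{2f}`. [folklore] -/
theorem rpow_half_add (f : ℝ) {n : ℕ} (hn : 1 ≤ n) : (n : ℝ) ^ ((1 : ℝ) / 2 + 2 * f) = Real.sqrt n * (n : ℝ) ^ (2 * f) := by
  rw [Real.rpow_add (by exact_mod_cast hn), Real.sqrt_eq_rpow]

/-- `1 ≤ n^{1/2+2f}`. [folklore] -/
theorem one_le_rpow_half_add {f : ℝ} (hf : 0 < f) {n : ℕ} (hn : 1 ≤ n) : (1 : ℝ) ≤ (n : ℝ) ^ ((1 : ℝ) / 2 + 2 * f) :=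
  Real.one_le_rpow (by exact_mod_cast hn) (by positivity)

/-- `n^{1/2+2f} ≤ n^{2k+1}`. [folklore] -/
theorem rpow_half_add_le_pow (f : ℝ) {n : ℕ} (hn : 1 ≤ n) : (n : ℝ) ^ ((1 : ℝ) / 2 + 2 * f) ≤ (n : ℝ) ^ (2 * kOf f + 1) := by
  have hk : f ≤ kOf f := Nat.le_ceil f
  calc (n : ℝ) ^ ((1 : ℝ) / 2 + 2 * f) ≤ (n : ℝ) ^ ((2 * kOf f + 1 : ℕ) : ℝ) :=
        Real.rpow_le_rpow_of_exponent_le (by exact_mod_cast hn) (by push_cast; linarith)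
    _ = (n : ℝ) ^ (2 * kOf f + 1) := Real.rpow_natCast _ _

/-- **The window of the radius guess**: for `0 < Q ≤ B`, with `ρ₀ = ⌊log₂ ⌊B/Q⌋⌋`,
`B/2 < Q · 2^{ρ₀} ≤ B`. [cite: Regev2004, Lemma 3.12 (proof, p. 14: the guess l of λ₁ up to a factor 2)] -/
theorem window_log {Q B : ℝ} (hQ : 0 < Q) (hQB : Q ≤ B) :
    B / 2 < Q * (2 : ℝ) ^ Nat.log 2 ⌊B / Q⌋₊ ∧ Q * (2 : ℝ) ^ Nat.log 2 ⌊B / Q⌋₊ ≤ B := by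
  set a := ⌊B / Q⌋₊ with ha
  have hBQ : 1 ≤ B / Q := by rw [le_div_iff₀ hQ, one_mul]; exact hQB
  have ha1 : 1 ≤ a := by rw [ha]; exact Nat.one_le_floor_iff _ |>.2 hBQ
  have h1 : (2 : ℝ) ^ Nat.log 2 a ≤ a := by exact_mod_cast Nat.pow_log_le_self 2 (by omega)
  have h2 : (a : ℝ) + 1 ≤ (2 : ℝ) ^ Nat.log 2 a * 2 := by
    have := Nat.lt_pow_succ_log_self (b := 2) (by norm_num) a
    rw [pow_succ] at this
    exact_mod_cast Nat.succ_le_of_lt this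
  have h3 : (a : ℝ) ≤ B / Q := Nat.floor_le (by positivity)
  have h4 : B / Q < a + 1 := Nat.lt_floor_add_one _
  constructor
  · have : B / Q < 2 ^ Nat.log 2 a * 2 := lt_of_lt_of_le h4 h2
    rw [div_lt_iff₀ hQ] at this
    linarith
  · have : (2 : ℝ) ^ Nat.log 2 a ≤ B / Q := h1.trans h3
    rw [le_div_iff₀ hQ] at this
    linarith

variable (f) in
/-- **The radius constant as a real**: `R(λ) = c_A n^{1/2+2f} λ`. [cite: Regev2004, Lemma 3.12 (proof, p. 14: R = c_bal n^{1/2+2f} l)] -/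
def radA (n : ℕ) (lam : ℝ) : ℝ := cA f * (n : ℝ) ^ ((1 : ℝ) / 2 + 2 * f) * lam

/-- `λ ≤ R(λ)`. [folklore] -/
theorem le_radA (hf : 0 < f) (hn : 1 ≤ n) {lam : ℝ} (hl : 0 ≤ lam) : lam ≤ radA f n lam := by
  unfold radA
  have h0 : 1 ≤ cA f := by unfold cA; have := Nat.one_le_pow (kOf f) 5 (by norm_num); omega
  have h1 : (1 : ℝ) ≤ cA f := by exact_mod_cast h0
  have h2 := one_le_rpow_half_add hf hn
  calc lam = 1 * 1 * lam := by ring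
    _ ≤ cA f * (n : ℝ) ^ ((1 : ℝ) / 2 + 2 * f) * lam := by gcongr

/-- `√2 < 1.415`. [folklore] -/
theorem sqrt_two_lt : Real.sqrt 2 < 1.415 := (Real.sqrt_lt' (by norm_num)).2 (by norm_num)

/-- `1/(5ᵏ n^{2k}) ≤ η`. [folklore] -/
theorem inv_pow_le_eta' (hf : 0 < f) (hn : 1 ≤ n) : 1 / ((5 : ℝ) ^ kOf f * (n : ℝ) ^ (2 * kOf f)) ≤ eta f n := by
  have h := inv_pow_le_eta hf hn
  rwa [mul_pow, ← pow_mul] at h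

/-- `1 ≤ c_A` and `c_A = 140 · 5ᵏ` as reals. [folklore] -/
theorem cA_cast (f : ℝ) : (cA f : ℝ) = 140 * (5 : ℝ) ^ kOf f := by unfold cA; push_cast; ring

/-- **The radius window**: from `R²/2 < QΔ ≤ R²` and `λ ≥ 2ⁿ`: `S = √(QΔ)` satisfies `0 < S ≤ R`,
`R ≤ √2 S`, `2ⁿ ≤ λ ≤ S`. [folklore] -/
theorem radius_window (hf : 0 < f) (hn : 1 ≤ n) {lam : ℝ} (hlam : (2 : ℝ) ^ n ≤ lam) {Q Δ : ℕ}
    (hlo : radA f n lam ^ 2 / 2 < (Q : ℝ) * Δ) (hhi : (Q : ℝ) * Δ ≤ radA f n lam ^ 2) :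
    0 < Real.sqrt ((Q : ℝ) * Δ) ∧ Real.sqrt ((Q : ℝ) * Δ) ≤ radA f n lam ∧
      radA f n lam ≤ Real.sqrt 2 * Real.sqrt ((Q : ℝ) * Δ) ∧ lam ≤ Real.sqrt ((Q : ℝ) * Δ) := by
  have hlam0 : 0 < lam := lt_of_lt_of_le (by positivity) hlam
  have hA : 140 * lam ≤ radA f n lam := by
    rw [radA, cA_cast]
    have h1 : (1 : ℝ) ≤ (5 : ℝ) ^ kOf f := one_le_pow₀ (by norm_num)
    have h2 := one_le_rpow_half_add hf hn
    calc 140 * lam = 140 * 1 * 1 * lam := by ring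
      _ ≤ 140 * (5 : ℝ) ^ kOf f * (n : ℝ) ^ ((1 : ℝ) / 2 + 2 * f) * lam := by gcongr
  have hA0 : 0 < radA f n lam := by linarith
  have hQΔ0 : 0 < (Q : ℝ) * Δ := lt_of_le_of_lt (by positivity) hlo
  have hS0 : 0 < Real.sqrt ((Q : ℝ) * Δ) := Real.sqrt_pos.2 hQΔ0
  have hS2 : Real.sqrt ((Q : ℝ) * Δ) ^ 2 = (Q : ℝ) * Δ := Real.sq_sqrt hQΔ0.le
  refine ⟨hS0, ?_, ?_, ?_⟩
  · apply (pow_le_pow_iff_left₀ hS0.le hA0.le two_ne_zero).1; rw [hS2]; exact hhi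
  · apply (pow_le_pow_iff_left₀ hA0.le (by positivity) two_ne_zero).1
    rw [mul_pow, Real.sq_sqrt (by norm_num), hS2]; linarith
  · apply (pow_le_pow_iff_left₀ hlam0.le hS0.le two_ne_zero).1
    rw [hS2]
    have : lam ^ 2 ≤ radA f n lam ^ 2 / 2 := by nlinarith
    linarith

/-- **The two small quantities**: `8n (n/Q + (√n + 1)/S) ≤ η/8` once `2ⁿ ≤ S`. [folklore] -/
theorem small_quantities (hf : 0 < f) (h : NumOK f n) {S : ℝ} (hS : (2 : ℝ) ^ n ≤ S) :
    8 * n * ((n : ℝ) / Qof f n + (Real.sqrt n + 1) / S) ≤ eta f n / 8 := by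
  have hn1 : 1 ≤ n := by have := h.four_le; omega
  have hn1r : (1 : ℝ) ≤ n := by exact_mod_cast hn1
  have hη := eta_pos f hn1
  have hS0 : 0 < S := lt_of_lt_of_le (by positivity) hS
  have hP : 0 < (5 : ℝ) ^ kOf f * (n : ℝ) ^ (2 * kOf f) := by positivity
  have hkey := inv_pow_le_eta' hf hn1
  -- `8n · n/Q ≤ η/16`
  have hw1 : 8 * n * ((n : ℝ) / Qof f n) ≤ eta f n / 16 := by
    have := div_Qof_le hf hn1
    have hn0 : (0 : ℝ) < n := by positivity
    calc 8 * n * ((n : ℝ) / Qof f n) ≤ 8 * n * (eta f n / (128 * n)) := by gcongr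
      _ = eta f n / 16 := by field_simp; ring
  -- `8n (√n + 1)/S ≤ 16 n²/2ⁿ ≤ η/16`
  have hrn : Real.sqrt n ≤ n := by
    calc Real.sqrt (n : ℝ) ≤ Real.sqrt ((n : ℝ) ^ 2) := Real.sqrt_le_sqrt (by nlinarith)
      _ = n := Real.sqrt_sq (by positivity)
  have he1 : (256 * 5 ^ kOf f * (n : ℝ) ^ (2 * kOf f + 2) : ℝ) ≤ (2 : ℝ) ^ n := by exact_mod_cast h.e1
  have h3 : 1 ≤ eta f n * ((5 : ℝ) ^ kOf f * (n : ℝ) ^ (2 * kOf f)) := by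
    have := mul_le_mul_of_nonneg_right hkey hP.le
    rwa [one_div, inv_mul_cancel₀ hP.ne'] at this
  have h4 : 256 * (n : ℝ) ^ 2 ≤ eta f n * (2 : ℝ) ^ n := by
    have e : (256 * 5 ^ kOf f * (n : ℝ) ^ (2 * kOf f + 2) : ℝ) = 256 * (n : ℝ) ^ 2 * ((5 : ℝ) ^ kOf f * (n : ℝ) ^ (2 * kOf f)) := by ring
    rw [e] at he1
    have h5 := mul_le_mul_of_nonneg_left he1 hη.le
    have h6 : 256 * (n : ℝ) ^ 2 * 1 ≤ 256 * (n : ℝ) ^ 2 * (eta f n * ((5 : ℝ) ^ kOf f * (n : ℝ) ^ (2 * kOf f))) :=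
      mul_le_mul_of_nonneg_left h3 (by positivity)
    linarith
  have hw2 : 8 * n * ((Real.sqrt n + 1) / S) ≤ eta f n / 16 := by
    have h1 : 8 * n * ((Real.sqrt n + 1) / S) ≤ 8 * n * ((2 * n) / (2 : ℝ) ^ n) := by
      gcongr
      · linarith
    refine h1.trans ?_
    rw [mul_div_assoc', div_le_div_iff₀ (by positivity) (by norm_num)]
    nlinarith
  have : 8 * ↑n * ((n : ℝ) / Qof f n + (Real.sqrt n + 1) / S) = 8 * n * ((n : ℝ) / Qof f n) + 8 * n * ((Real.sqrt n + 1) / S) := by ring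
  linarith

/-- **The ratio term**: `6 √n λ / S ≤ η/16` for `R(λ) ≤ √2 S` (`c_A = 140·5ᵏ ≥ 96 √2 · 5ᶠ`). [folklore] -/
theorem ratio_term (hf : 0 < f) (hn : 1 ≤ n) {lam S : ℝ} (hlam : 0 < lam) (hS : 0 < S) (hSA : radA f n lam ≤ Real.sqrt 2 * S) :
    6 * Real.sqrt n * lam / S ≤ eta f n / 16 := by
  have hn0 : (0 : ℝ) < n := by exact_mod_cast hn
  have hrn0 : 0 < Real.sqrt n := Real.sqrt_pos.2 hn0
  have hn2f : (0 : ℝ) < (n : ℝ) ^ (2 * f) := Real.rpow_pos_of_pos hn0 _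
  have h5k : (0 : ℝ) < (5 : ℝ) ^ kOf f := by positivity
  have hη := eta_pos f hn
  have hA_eq : radA f n lam = 140 * (5 : ℝ) ^ kOf f * (Real.sqrt n * (n : ℝ) ^ (2 * f)) * lam := by
    rw [radA, cA_cast, rpow_half_add f hn]
  -- `1/S ≤ √2/R`
  have hA0 : 0 < radA f n lam := by rw [hA_eq]; positivity
  have h1 : 6 * Real.sqrt n * lam / S ≤ 6 * Real.sqrt n * lam * Real.sqrt 2 / radA f n lam := by
    rw [div_le_div_iff₀ hS hA0]
    have h6 : 0 ≤ 6 * Real.sqrt n * lam := by positivity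
    calc 6 * Real.sqrt n * lam * radA f n lam ≤ 6 * Real.sqrt n * lam * (Real.sqrt 2 * S) := mul_le_mul_of_nonneg_left hSA h6
      _ = 6 * Real.sqrt n * lam * Real.sqrt 2 * S := by ring
  -- `= 6√2/(140·5ᵏ) · n^{-2f}`
  have h2 : 6 * Real.sqrt n * lam * Real.sqrt 2 / radA f n lam = 6 * Real.sqrt 2 / (140 * (5 : ℝ) ^ kOf f) * (n : ℝ) ^ (-(2 * f)) := by
    rw [hA_eq, Real.rpow_neg hn0.le]; field_simp
  -- `n^{-2f} ≤ 5ᵏ η`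
  have h3 : (n : ℝ) ^ (-(2 * f)) ≤ 5 ^ kOf f * eta f n := by
    have := rpow_neg_div_eta_le hf hn
    rwa [div_le_iff₀ hη] at this
  have h22 := sqrt_two_lt
  calc 6 * Real.sqrt n * lam / S ≤ 6 * Real.sqrt 2 / (140 * (5 : ℝ) ^ kOf f) * (n : ℝ) ^ (-(2 * f)) := by rw [← h2]; exact h1
    _ ≤ 6 * Real.sqrt 2 / (140 * (5 : ℝ) ^ kOf f) * (5 ^ kOf f * eta f n) := by gcongr
    _ = 6 * Real.sqrt 2 / 140 * eta f n := by field_simp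
    _ ≤ eta f n / 16 := by nlinarith [Real.sqrt_nonneg (2 : ℝ)]

/-- **The box term**: `(∑|δᵢ|)/2^{4n} ≤ η/2` for `∑|δᵢ| ≤ n 2^{2n} + p`. [folklore] -/
theorem box_term (hf : 0 < f) (h : NumOK f n) {D : ℝ} (hD : D ≤ n * (2 : ℝ) ^ (2 * n) + pOf f n) :
    D / (2 : ℝ) ^ (4 * n) ≤ eta f n / 2 := by
  have hn1 : 1 ≤ n := by have := h.four_le; omega
  have hη := eta_pos f hn1
  have hP : 0 < (5 : ℝ) ^ kOf f * (n : ℝ) ^ (2 * kOf f) := by positivity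
  have hkey := inv_pow_le_eta' hf hn1
  have he2 : (4 * 5 ^ kOf f * (n : ℝ) ^ (2 * kOf f + 1) : ℝ) ≤ (2 : ℝ) ^ n := by exact_mod_cast h.e2
  have he3 : (4 * 5 ^ kOf f * (n : ℝ) ^ (2 * kOf f) * pOf f n : ℝ) ≤ (2 : ℝ) ^ n := by exact_mod_cast h.e3
  -- with `T = 2ⁿ ≥ 1`, `P = 5ᵏ n^{2k}`
  have e4 : (2 : ℝ) ^ (4 * n) = ((2 : ℝ) ^ n) ^ 4 := by rw [mul_comm, pow_mul]
  have e2 : (2 : ℝ) ^ (2 * n) = ((2 : ℝ) ^ n) ^ 2 := by rw [mul_comm, pow_mul]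
  rw [e4]
  rw [e2] at hD
  generalize hT : (2 : ℝ) ^ n = T at hD he2 he3
  have hT1 : 1 ≤ T := by rw [← hT]; exact one_le_pow₀ (by norm_num)
  generalize hPP : (5 : ℝ) ^ kOf f * (n : ℝ) ^ (2 * kOf f) = P at hP hkey he2 he3
  have he2' : (n : ℝ) * (4 * P) ≤ T := by rw [← hPP]; rw [pow_succ] at he2; linarith
  have he3' : (pOf f n : ℝ) * (4 * P) ≤ T := by rw [← hPP]; linarith
  have h3 : 1 ≤ eta f n * P := by
    have := mul_le_mul_of_nonneg_right hkey hP.le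
    rwa [one_div, inv_mul_cancel₀ hP.ne'] at this
  have hT0 : 0 ≤ T := by linarith
  have hT3 : T ≤ T ^ 4 := by
    calc T = T * 1 := (mul_one T).symm
      _ ≤ T * T ^ 3 := mul_le_mul_of_nonneg_left (one_le_pow₀ hT1) hT0
      _ = T ^ 4 := by ring
  have hT34 : T ^ 3 ≤ T ^ 4 := by
    calc T ^ 3 = T ^ 3 * 1 := (mul_one _).symm
      _ ≤ T ^ 3 * T := mul_le_mul_of_nonneg_left hT1 (by positivity)
      _ = T ^ 4 := by ring
  have hA : (n : ℝ) * T ^ 2 * (4 * P) ≤ T ^ 4 := by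
    calc (n : ℝ) * T ^ 2 * (4 * P) = T ^ 2 * ((n : ℝ) * (4 * P)) := by ring
      _ ≤ T ^ 2 * T := mul_le_mul_of_nonneg_left he2' (by positivity)
      _ = T ^ 3 := by ring
      _ ≤ T ^ 4 := hT34
  have hB : (pOf f n : ℝ) * (4 * P) ≤ T ^ 4 := he3'.trans hT3
  have hsum : ((n : ℝ) * T ^ 2 + pOf f n) * P ≤ T ^ 4 / 2 := by
    have e : ((n : ℝ) * T ^ 2 + pOf f n) * P = ((n : ℝ) * T ^ 2 * (4 * P) + (pOf f n : ℝ) * (4 * P)) / 4 := by ring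
    rw [e]; linarith
  have hX0 : 0 ≤ (n : ℝ) * T ^ 2 + pOf f n := by positivity
  rw [div_le_iff₀ (by positivity)]
  have h7 : (n : ℝ) * T ^ 2 + pOf f n ≤ ((n : ℝ) * T ^ 2 + pOf f n) * (eta f n * P) := le_mul_of_one_le_right hX0 h3
  have h8 : ((n : ℝ) * T ^ 2 + pOf f n) * (eta f n * P) ≤ eta f n * (T ^ 4 / 2) := by
    have := mul_le_mul_of_nonneg_left hsum hη.le
    linarith [this]
  linarith

/-- **The numerical budget of Claim 3.14** at a dimension where the eventual inequalities hold:
if `λ ≥ 2ⁿ`, the quantised ball has `Q = Qof f n` levels and cell size `Δ` with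
`R(λ)²/2 < QΔ ≤ R(λ)²`, and `∑ |δᵢ| ≤ n 2^{2n} + p`, then `(∑|δᵢ|)/2^{4n} + 2 ε ≤ η`; moreover
`5√n ≤ √(QΔ)` (so `0 < innerRad`). [cite: Regev2004, Claim 3.14 (p. 15: "both error terms are at most 1/(c (log N)^f)")] -/
theorem budget (hf : 0 < f) (h : NumOK f n) {lam : ℝ} (hlam : (2 : ℝ) ^ n ≤ lam) {Δ : ℕ}
    (hlo : radA f n lam ^ 2 / 2 < (Qof f n : ℝ) * Δ) (hhi : (Qof f n : ℝ) * Δ ≤ radA f n lam ^ 2)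
    {D : ℝ} (hD : D ≤ n * (2 : ℝ) ^ (2 * n) + pOf f n) :
    5 * Real.sqrt n ≤ Real.sqrt ((Qof f n : ℝ) * Δ) ∧
      D / (2 : ℝ) ^ (4 * n) + 2 * shiftEps (n - 1) (Qof f n) Δ lam ≤ eta f n := by
  have hn1 : 1 ≤ n := by have := h.four_le; omega
  have hη1 := eta_le_one hf hn1
  have hη := eta_pos f hn1
  have hlam0 : 0 < lam := lt_of_lt_of_le (by positivity) hlam
  obtain ⟨hS0, -, hSA, hlamS⟩ := radius_window hf hn1 hlam hlo hhi
  have hS2n : (2 : ℝ) ^ n ≤ Real.sqrt ((Qof f n : ℝ) * Δ) := hlam.trans hlamS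
  have h5 : 5 * Real.sqrt n ≤ Real.sqrt ((Qof f n : ℝ) * Δ) := (five_sqrt_le_two_pow h).trans hS2n
  have hσ : 2 * Real.sqrt n ≤ lam := by linarith [five_sqrt_le_two_pow h, Real.sqrt_nonneg (n : ℝ)]
  have hε := shiftEps_le_of_small hn1 (two_mul_le_Qof f n) h5 hσ (by linarith : eta f n / 8 ≤ 1) (small_quantities hf h hS2n)
  have hr := ratio_term hf hn1 hlam0 hS0 hSA
  have hb := box_term hf h hD
  refine ⟨h5, ?_⟩
  linarith

/-- **`0 < innerRad`** under the budget's hypotheses. [folklore] -/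
theorem innerRad_pos_of_window (hf : 0 < f) (h : NumOK f n) {lam : ℝ} (hlam : (2 : ℝ) ^ n ≤ lam) {Δ : ℕ}
    (hlo : radA f n lam ^ 2 / 2 < (Qof f n : ℝ) * Δ) (hhi : (Qof f n : ℝ) * Δ ≤ radA f n lam ^ 2) :
    0 < innerRad (n - 1) (Qof f n) Δ := by
  have hn1 : 1 ≤ n := by have := h.four_le; omega
  obtain ⟨hS0, -⟩ := radius_window hf hn1 hlam hlo hhi
  have h5 := (budget hf h hlam hlo hhi (D := 0) (by positivity)).1
  exact innerRad_pos_of hn1 (two_mul_le_Qof f n) h5 hS0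

end Consequences

end Regev2004

end Literature.Algebra.EuclideanLattices

end
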